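import Summits.QuantumFields.YangMills.Theorems.UnitScaleTiltProp7QkcReadSet
import Summits.QuantumFields.YangMills.Theorems.UnitScaleTiltProp7TwistedIntertwiningRows
import HarnessLib

/-!
# Route `UnitScaleTilt`, crux K1 «MinimiserStabilityRegPr» (stmt-QuantumFields-19200), LANE II «DIVERGENCE RECOVERY AT CURVED `W`» (★★OWNER RULING №23), [I-9]∕h9
# (★p1 g19 RECIPE v2 (D) step 5 «h9 ← `intertwining_rows_on` + (QH1)♮ + fibre locality»): **THE INNER-PATCH COARSE-GRADIENT ROW MODULO (QH1)♮** — the first and third factors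
# composed: on the inner coarse bonds of a patch the coarse covariant gradient of the comb means of the local potential `φ` is bounded by the `As`-sum of `y`, the slot norm
# `‖Qkc W (Zb r)‖²` of the cut-off residual one-form (the argument of (QH1)♮), and the (B3a) defect.

Cell `ym3-torus` (HUMAN RULING D-0037, YM ladder rung R3 — YM₃ on T³ is a rung, NOT d = 4, NOT infinite volume, NOT a mass gap, NOT Clay; YM gap NOT proved), width seat
`ym-ust-19200-w1` (gen 16).  THEOREMS ONLY (0 `def`, 0 `sorry`); `--supports stmt-QuantumFields-19200 --as helper`; count-neutral.

WHAT IS PROVED (sorry-free, no definition; `k = K − n`, `ℓ = Lᵏ`, `ĉ : PBond (F.P K) (K − n)` a coarse bond, fibres read at `bondShift⁻¹ ĉ` as in ✓`Prop7TwistedIntertwining.fibre_Qkc_DL2_eq`;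
«inner» = the cutoff `ζ` behind the bond multiplier `Zb` ((Z2)-reading `toL2⁻¹(Zb f) b = ζ(b₋) • toL2⁻¹ f b`) equals `1` at every fine site whose `k`-block is within cyclic sup-distance `2`
of `ĉ₋` — the read predicate of ✓`Prop7QkcReadSet`).
* §1 ★`fibre_Qkc_DL2_eq_sub_on_inner` — from the local equation `Zb (DL2 W φ) = Zb y − Zb r` (✓`Prop7DivRecoveryCutoffReadings.patch_hDφ`'s output at the `ζ̃`-multiplier):
  `fibre (Qkc W (DL2 W φ)) ĉ = fibre (Qkc W y) ĉ − fibre (Qkc W (Zb r)) ĉ` on every inner `ĉ` (✓`fibre_Qkc_mul_eq_of_eq_one_on_reads` twice).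
* §2 `sum_fibre_sq_le_norm_sq` — `cB·Σ_{ĉ∈S} ‖fibre g ĉ‖² ≤ ‖g‖²` for every coarse block field `g` and every `S` (`WL2.norm_sq`, `bondShift` reindexing);
  ★★`sum_fibre_Qkc_DL2_le_on_inner` — `cB·Σ_{ĉ∈S} ‖fibre (Qkc W (DL2 W φ)) ĉ‖² ≤ 2·(cB·Σ_{ĉ∈S} ‖fibre (Qkc W y) ĉ‖²) + 2·‖Qkc W (Zb r)‖²` for `S` inner.
* §3 ★★★`coarseGrad_rows_on_inner` — with ✓`intertwining_rows_on` (window `e3`, defect constant `C3`) and the read-set window `10⁹L³e ≤ 1`: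
  `cB·Σ_{ĉ∈S} ‖Ad(T ĉ)(Q′φ)(ĉ₊) − (Q′φ)(ĉ₋)‖² ≤ 4·(cB·Σ_{ĉ∈S} ‖fibre (Qkc W y) ĉ‖²) + 4·‖Qkc W (Zb r)‖² + C3·e²·ℓ⁻³·‖φ‖²` — h9 of ✓`patch_budget` then follows by (QH1)♮ at
  `f := Zb r` and h10; those two rows are NOT used here.
HONEST SCOPE.  Composition of landed identities and `‖a − b‖² ≤ 2‖a‖² + 2‖b‖²`; no estimate of print; nothing of (QH1)♮∕`hPatch`∕(REC)∕hN06∕EX∕the crux is claimed.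

References: T. Bałaban, CMP **99** (1985) 389–434 [Balaban1985BackgroundPropagators] ((3.114)–(3.115) p.418, (3.14)–(3.16) p.393, (3.100) p.413); CMP **98** (1985) 17–51
[Balaban1985Averaging] ((110) p.34); CMP **102** (1985) 277–309 [Balaban1985Variational] ((44) p.285).
-/

set_option autoImplicit false

noncomputable section

namespace Summit.QuantumFields.YangMills.Theorems.Prop7QkcInnerPatchRows

open scoped Matrix.Norms.L2Operator InnerProductSpace BigOperators
open Literature.MathematicalPhysics.QuantumFieldTheory.Balaban1983to89
open Literature.MathematicalPhysics.QuantumFieldTheory.Balaban1983to89.T3ContinuumYM3Torus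
open T3PrintedRegularMinimiser (RegPr)
open T3PrintedRegularOrbits (sites_eq)
open T3SectALandauChart (eta eta_pos bgUnits)
open T3LevelShift (siteShift bondShift)
open B5Eq118OneStroke (iterBlockOf)
open B9Eq311L2Pairing (WL2)
open B11Eq103H1Complex (SiteL2K BondL2K)
open Summit.QuantumFields.YangMills.Theorems.Prop7SymAvgGL (descendToGL)
open Summit.QuantumFields.YangMills.Theorems.Prop7SectET3Transport (periodsT3)
open Summit.QuantumFields.YangMills.Theorems.Prop7SectET3HilbertLetters (W₂ toL2 DL2)
open Summit.QuantumFields.YangMills.Theorems.Prop7SectET3CombLetters (Qkc)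
open Summit.QuantumFields.YangMills.Theorems.Prop7QprimeCombL2 (QprimeCombL2)
open Summit.QuantumFields.YangMills.Theorems.Prop7QkcReadSet (fibre_Qkc_mul_eq_of_eq_one_on_reads)
open Summit.QuantumFields.YangMills.Theorems.Prop7TwistedIntertwining (intertwining_rows_on)

variable (F : T3Family) (n K : ℕ) (h : n ≤ K)

/-! ## §1 The fibre of `Qkc W (DL2 W φ)` on an inner bond, from the local equation -/

section Pointwise

variable {c₀ cB : ℝ} [Fact (0 < c₀)]
variable {e : ℝ} (he : 0 < e) (hw : 10 ^ 9 * (F.L : ℝ) ^ 3 * e ≤ 1)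
  (W : GaugeField (F.P K) 0 (Matrix.specialUnitaryGroup (Fin 2) ℂ)) (hreg : RegPr F n K e W)

include he hw hreg in
/-- ★ **THE SLOT FIBRE OF THE LOCAL GRADIENT ON AN INNER BOND**: if the bond multiplier `Zb` (cutoff `ζ`, (Z2)-reading) satisfies the local equation `Zb (DL2 W φ) = Zb y − Zb r` and `ζ = 1`
on every fine site whose `k`-block is within cyclic sup-distance `2` of `ĉ₋`, then `fibre (Qkc W (DL2 W φ)) ĉ = fibre (Qkc W y) ĉ − fibre (Qkc W (Zb r)) ĉ`.
[cite: Balaban1985BackgroundPropagators, (3.100) p.413, (3.14)–(3.16) p.393; Balaban1985Averaging, (110) p.34] -/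
theorem fibre_Qkc_DL2_eq_sub_on_inner (ζ : Site (F.P K) 0 → ℝ)
    (Zb : BondL2K ℂ 3 (periodsT3 F K) c₀ W₂ →ₗ[ℂ] BondL2K ℂ 3 (periodsT3 F K) c₀ W₂)
    (hZb : ∀ (f : BondL2K ℂ 3 (periodsT3 F K) c₀ W₂) (b : PBond (F.P K) 0), (toL2 F K c₀).symm (Zb f) b = ζ b.src • (toL2 F K c₀).symm f b)
    (chat : PBond (F.P K) (K - n))
    (hζ : ∀ x : Site (F.P K) 0,
      (∀ κ : Fin (F.P K).d, min ((iterBlockOf (K - n) x) κ - chat.src κ).val (chat.src κ - (iterBlockOf (K - n) x) κ).val ≤ 2) → ζ x = 1)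
    (φ : SiteL2K ℂ 3 (periodsT3 F K) c₀ W₂) (y r : BondL2K ℂ 3 (periodsT3 F K) c₀ W₂)
    (hDφ : Zb (DL2 F n K c₀ W φ) = Zb y - Zb r) :
    WL2.equiv ℂ (fun _ : PBond (F.P n) 0 => cB) W₂ (Qkc F n K h c₀ cB W (DL2 F n K c₀ W φ)) ((bondShift (sites_eq F n K h)).symm chat)
      = WL2.equiv ℂ (fun _ : PBond (F.P n) 0 => cB) W₂ (Qkc F n K h c₀ cB W y) ((bondShift (sites_eq F n K h)).symm chat)
        - WL2.equiv ℂ (fun _ : PBond (F.P n) 0 => cB) W₂ (Qkc F n K h c₀ cB W (Zb r)) ((bondShift (sites_eq F n K h)).symm chat) := by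
  rw [← fibre_Qkc_mul_eq_of_eq_one_on_reads F n K h he hw W hreg ζ Zb hZb chat hζ (DL2 F n K c₀ W φ), hDφ, map_sub, WL2.equiv_sub, Pi.sub_apply,
    fibre_Qkc_mul_eq_of_eq_one_on_reads F n K h he hw W hreg ζ Zb hZb chat hζ y]

end Pointwise

/-! ## §2 Sums over an inner set of coarse bonds -/

section Sums

variable {c₀ cB : ℝ} [Fact (0 < c₀)] [Fact (0 < cB)]

omit [Fact (0 < c₀)] in
/-- **A PARTIAL FIBRE SUM IS BOUNDED BY THE NORM**: `cB·Σ_{ĉ∈S} ‖fibre g ĉ‖² ≤ ‖g‖²` for every coarse block field `g ∈ L²(cB)` and every finite set `S` of coarse bonds (read through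
`bondShift⁻¹`). [cite: Balaban1985BackgroundPropagators, (3.16) p.393] -/
theorem sum_fibre_sq_le_norm_sq (S : Finset (PBond (F.P K) (K - n))) (g : WL2 ℂ (fun _ : PBond (F.P n) 0 => cB) W₂) :
    cB * ∑ c ∈ S, ‖WL2.equiv ℂ (fun _ : PBond (F.P n) 0 => cB) W₂ g ((bondShift (sites_eq F n K h)).symm c)‖ ^ 2 ≤ ‖g‖ ^ 2 := by
  have hcB : 0 < cB := Fact.out
  rw [WL2.norm_sq, Finset.mul_sum]
  -- reindex the partial sum along `bondShift⁻¹` and compare with the full sum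
  have hre : ∑ c ∈ S, cB * ‖WL2.equiv ℂ (fun _ : PBond (F.P n) 0 => cB) W₂ g ((bondShift (sites_eq F n K h)).symm c)‖ ^ 2
      = ∑ c ∈ S.map (bondShift (sites_eq F n K h)).symm.toEmbedding, cB * ‖WL2.equiv ℂ (fun _ : PBond (F.P n) 0 => cB) W₂ g c‖ ^ 2 := by
    rw [Finset.sum_map]
    rfl
  rw [hre]
  exact Finset.sum_le_univ_sum_of_nonneg fun c => by positivity

variable {e : ℝ} (he : 0 < e) (hw : 10 ^ 9 * (F.L : ℝ) ^ 3 * e ≤ 1)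
  (W : GaugeField (F.P K) 0 (Matrix.specialUnitaryGroup (Fin 2) ℂ)) (hreg : RegPr F n K e W)

include he hw hreg in
/-- ★★ **THE INNER SLOT SUM OF THE LOCAL GRADIENT**: for a set `S` of inner coarse bonds (the cutoff behind `Zb` is `1` on the blocks within distance `2` of each `ĉ₋`, `ĉ ∈ S`) and the
local equation `Zb (DL2 W φ) = Zb y − Zb r`: `cB·Σ_{ĉ∈S} ‖fibre (Qkc W (DL2 W φ)) ĉ‖² ≤ 2·(cB·Σ_{ĉ∈S} ‖fibre (Qkc W y) ĉ‖²) + 2·‖Qkc W (Zb r)‖²`.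
[cite: Balaban1985BackgroundPropagators, (3.100) p.413, (3.14)–(3.16) p.393] -/
theorem sum_fibre_Qkc_DL2_le_on_inner (ζ : Site (F.P K) 0 → ℝ)
    (Zb : BondL2K ℂ 3 (periodsT3 F K) c₀ W₂ →ₗ[ℂ] BondL2K ℂ 3 (periodsT3 F K) c₀ W₂)
    (hZb : ∀ (f : BondL2K ℂ 3 (periodsT3 F K) c₀ W₂) (b : PBond (F.P K) 0), (toL2 F K c₀).symm (Zb f) b = ζ b.src • (toL2 F K c₀).symm f b)
    (S : Finset (PBond (F.P K) (K - n)))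
    (hS : ∀ chat ∈ S, ∀ x : Site (F.P K) 0,
      (∀ κ : Fin (F.P K).d, min ((iterBlockOf (K - n) x) κ - chat.src κ).val (chat.src κ - (iterBlockOf (K - n) x) κ).val ≤ 2) → ζ x = 1)
    (φ : SiteL2K ℂ 3 (periodsT3 F K) c₀ W₂) (y r : BondL2K ℂ 3 (periodsT3 F K) c₀ W₂)
    (hDφ : Zb (DL2 F n K c₀ W φ) = Zb y - Zb r) :
    cB * ∑ c ∈ S, ‖WL2.equiv ℂ (fun _ : PBond (F.P n) 0 => cB) W₂ (Qkc F n K h c₀ cB W (DL2 F n K c₀ W φ)) ((bondShift (sites_eq F n K h)).symm c)‖ ^ 2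
      ≤ 2 * (cB * ∑ c ∈ S, ‖WL2.equiv ℂ (fun _ : PBond (F.P n) 0 => cB) W₂ (Qkc F n K h c₀ cB W y) ((bondShift (sites_eq F n K h)).symm c)‖ ^ 2)
        + 2 * ‖Qkc F n K h c₀ cB W (Zb r)‖ ^ 2 := by
  have hcB : 0 < cB := Fact.out
  -- bond by bond: `‖a − b‖² ≤ 2‖a‖² + 2‖b‖²`
  have hpt : ∀ c ∈ S,
      ‖WL2.equiv ℂ (fun _ : PBond (F.P n) 0 => cB) W₂ (Qkc F n K h c₀ cB W (DL2 F n K c₀ W φ)) ((bondShift (sites_eq F n K h)).symm c)‖ ^ 2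
        ≤ 2 * ‖WL2.equiv ℂ (fun _ : PBond (F.P n) 0 => cB) W₂ (Qkc F n K h c₀ cB W y) ((bondShift (sites_eq F n K h)).symm c)‖ ^ 2
          + 2 * ‖WL2.equiv ℂ (fun _ : PBond (F.P n) 0 => cB) W₂ (Qkc F n K h c₀ cB W (Zb r)) ((bondShift (sites_eq F n K h)).symm c)‖ ^ 2 := by
    intro c hc
    rw [fibre_Qkc_DL2_eq_sub_on_inner F n K h he hw W hreg ζ Zb hZb c (hS c hc) φ y r hDφ]
    set a := WL2.equiv ℂ (fun _ : PBond (F.P n) 0 => cB) W₂ (Qkc F n K h c₀ cB W y) ((bondShift (sites_eq F n K h)).symm c)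
    set b := WL2.equiv ℂ (fun _ : PBond (F.P n) 0 => cB) W₂ (Qkc F n K h c₀ cB W (Zb r)) ((bondShift (sites_eq F n K h)).symm c)
    have h1 := norm_sub_le a b
    have h2 := norm_nonneg (a - b)
    nlinarith [norm_nonneg a, norm_nonneg b, sq_nonneg (‖a‖ - ‖b‖)]
  have hsum := Finset.sum_le_sum hpt
  rw [Finset.sum_add_distrib, ← Finset.mul_sum, ← Finset.mul_sum] at hsum
  have h3 := sum_fibre_sq_le_norm_sq F n K h S (Qkc F n K h c₀ cB W (Zb r))
  nlinarith [mul_le_mul_of_nonneg_left hsum hcB.le]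

end Sums

/-! ## §3 The inner-patch coarse-gradient row modulo (QH1)♮ -/

section Row

variable (c₀ cB : ℕ → ℝ) [hc₀ : ∀ L : ℕ, Fact (0 < c₀ L)] [hcB : ∀ L : ℕ, Fact (0 < cB L)]

/-- ★★★ **h9 MODULO (QH1)♮ — THE INNER-PATCH COARSE-GRADIENT ROW**: for every `L > 1` there are `C3 ≥ 0` (the (B3a) defect constant of ✓`intertwining_rows_on`) and a window `e9 > 0` such that
at every printed-regular member `W ∈ RegPr F n K e`, `0 ≤ e ≤ e9`, for every cutoff `ζ` ∕ bond multiplier `Zb` with the (Z2)-reading, every set `S` of inner coarse bonds (`ζ = 1` on the blocks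
within cyclic sup-distance `2` of each `ĉ₋`), every potential `φ` and one-forms `y, r` with the local equation `Zb (DL2 W φ) = Zb y − Zb r`:
`cB·Σ_{ĉ∈S} ‖Ad(T ĉ)(Q′φ)(ĉ₊) − (Q′φ)(ĉ₋)‖² ≤ 4·(cB·Σ_{ĉ∈S} ‖fibre (Qkc W y) ĉ‖²) + 4·‖Qkc W (Zb r)‖² + C3·e²·ℓ⁻³·‖φ‖²` (`T ĉ = D̄_GL(W)(bondShift⁻¹ ĉ)`, `Q′ = QprimeCombL2 W φ` — the
left side of ✓`intertwining_rows_on` VERBATIM).  h9 of ✓`patch_budget` follows by (QH1)♮ at `f := Zb r` and h10 (not used here).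
[cite: Balaban1985BackgroundPropagators, (3.114)–(3.115) p.418, (3.100) p.413, (3.16) p.393] -/
theorem coarseGrad_rows_on_inner : ∀ (L : ℕ), 1 < L → ∃ C3 e9 : ℝ, 0 ≤ C3 ∧ 0 < e9 ∧
    ∀ (F : T3Family), F.L = L → ∀ (n K : ℕ) (hnK : n < K) (e : ℝ), 0 ≤ e → e ≤ e9 →
      ∀ (W : GaugeField (F.P K) 0 (Matrix.specialUnitaryGroup (Fin 2) ℂ)), RegPr F n K e W →
        ∀ (ζ : Site (F.P K) 0 → ℝ) (Zb : BondL2K ℂ 3 (periodsT3 F K) (c₀ F.L) W₂ →ₗ[ℂ] BondL2K ℂ 3 (periodsT3 F K) (c₀ F.L) W₂),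
          (∀ (f : BondL2K ℂ 3 (periodsT3 F K) (c₀ F.L) W₂) (b : PBond (F.P K) 0), (toL2 F K (c₀ F.L)).symm (Zb f) b = ζ b.src • (toL2 F K (c₀ F.L)).symm f b) →
          ∀ (S : Finset (PBond (F.P K) (K - n))),
            (∀ chat ∈ S, ∀ x : Site (F.P K) 0,
              (∀ κ : Fin (F.P K).d, min ((iterBlockOf (K - n) x) κ - chat.src κ).val (chat.src κ - (iterBlockOf (K - n) x) κ).val ≤ 2) → ζ x = 1) →
            ∀ (φ : SiteL2K ℂ 3 (periodsT3 F K) (c₀ F.L) W₂) (y r : BondL2K ℂ 3 (periodsT3 F K) (c₀ F.L) W₂),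
              Zb (DL2 F n K (c₀ F.L) W φ) = Zb y - Zb r →
              cB F.L * ∑ c ∈ S, ‖B7Eq78Linearization.conjR (descendToGL F n K hnK.le (bgUnits F K W) ((bondShift (sites_eq F n K hnK.le)).symm c))
                  (QprimeCombL2 F n K (c₀ F.L) W φ (c.src.shift c.dir)) - QprimeCombL2 F n K (c₀ F.L) W φ c.src‖ ^ 2
                ≤ 4 * (cB F.L * ∑ c ∈ S, ‖WL2.equiv ℂ (fun _ : PBond (F.P n) 0 => cB F.L) W₂
                      (Qkc F n K hnK.le (c₀ F.L) (cB F.L) W y) ((bondShift (sites_eq F n K hnK.le)).symm c)‖ ^ 2)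
                  + 4 * ‖Qkc F n K hnK.le (c₀ F.L) (cB F.L) W (Zb r)‖ ^ 2
                  + C3 * e ^ 2 * ((((F.L : ℝ) ^ (K - n)) ^ 3)⁻¹ * ‖φ‖ ^ 2) := by
  intro L hL
  obtain ⟨C3, e3, hC3, he3, hrows⟩ := intertwining_rows_on c₀ cB L hL
  have hL3 : (0 : ℝ) < 10 ^ 9 * (L : ℝ) ^ 3 := by positivity
  refine ⟨C3, min e3 (1 / (10 ^ 9 * (L : ℝ) ^ 3)), hC3, lt_min he3 (by positivity), ?_⟩
  intro F hF n K hnK e he0 hle W hreg ζ Zb hZb S hS φ y r hDφ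
  -- the two windows
  have hle3 : e ≤ e3 := hle.trans (min_le_left _ _)
  set e9 : ℝ := min e3 (1 / (10 ^ 9 * (L : ℝ) ^ 3)) with he9
  have he9pos : 0 < e9 := lt_min he3 (by positivity)
  have hw9 : 10 ^ 9 * (F.L : ℝ) ^ 3 * e9 ≤ 1 := by
    rw [hF]
    have h1 : e9 ≤ 1 / (10 ^ 9 * (L : ℝ) ^ 3) := min_le_right _ _
    rwa [le_div_iff₀ hL3, mul_comm] at h1
  have hreg9 : RegPr F n K e9 W := T3PrintedMinimiserExistence.regPr_mono F hle hreg
  -- (B3a-loc) on `S`, then the inner slot sum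
  have h1 := hrows F hF n K hnK e he0 hle3 W hreg S φ
  have h2 := sum_fibre_Qkc_DL2_le_on_inner F n K hnK.le (c₀ := c₀ F.L) (cB := cB F.L) he9pos hw9 W hreg9 ζ Zb hZb S hS φ y r hDφ
  linarith [h1, h2]

end Row

end Summit.QuantumFields.YangMills.Theorems.Prop7QkcInnerPatchRows

end
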